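import Summits.QuantumFields.YangMills.Theorems.LuscherReductionDressedRitzPolyakovLiftBlockPlateau
import Summits.QuantumFields.YangMills.Theorems.LuscherReductionDressedRitzLevelHeredity
import HarnessLib

/-!
# Route `LuscherReduction`, item `DressedRitz` (stmt-QuantumFields-20205), line «polyakovlift» — LEVEL HEREDITY of the typed r10 option
# `BlockPlateauForL (TransplantBasisLR k)` (ONE joint ∃-basis block text, `dressedRitz_of_blockPlateau`, p593581)

Prover seat ymfull-r2b-prover-1 (cell ym-gapexp, R590-ym item (10)), `--supports stmt-QuantumFields-20205 --as helper`.  Companion of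
`…DressedRitzLevelHeredity` (p783553: the route decl's slices and the r9 ∃-stub `BlockPositionForL (TransplantBasisLR k)` are downward hereditary
in the level).  The LEAD's typed r10 OPTION (LEAD g4 `BLOCK-CURRENCY-g4.md` §6; cdisprove g14 (G14-e) pre-vetted, NOT registered — owner's call) replaces
r9's three stubs by ONE joint ∃-basis text `∀ k, BlockPlateauForL (TransplantBasisLR k)`; being an ∃-text with channel-wise ∕ pair-wise clauses it is
downward hereditary by RESTRICTION of the basis exactly like BLOCK-POS:

* ★ `PolyakovLift.blockPlateauForL_transplantLR_of_le : k ≤ k' → BlockPlateauForL (TransplantBasisLR k') → BlockPlateauForL (TransplantBasisLR k)`,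
  `…_of_cofinal`; so, were r10 registered, its single stub could be supplied along any cofinal set of levels (e.g. at tops of complete 𝔥-multiplets,
  where the level-rotation hazards (G10)/(G11) of the ∀-texts do not arise for an ∃-text by design), and `dressedRitz_of_blockPlateau` would still
  conclude the item BY NAME (`dressedRitz_of_blockPlateau_cofinal`).

HONEST FRAMING: bookkeeping on an UNREGISTERED option of an open line on the CONDITIONAL femto rung R2b1; proves nothing of `DressedRitz`; nothing
here bears on infinite volume, the continuum limit or the Clay gap — the Yang–Mills mass gap is NOT proved.
References: M. Lüscher, NPB 219 (1983) 233 [cite: Luscher1983, §3].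
-/

set_option autoImplicit false

noncomputable section

open MeasureTheory Filter Topology Real
open Literature.MathematicalPhysics.QuantumFieldTheory (GaugeConfig Site gaugeTransform)
open scoped BigOperators

namespace Summit.QuantumFields.YangMills.Theorems.FemtoTransferGap.PolyakovLift

open Summit.QuantumFields.YangMills.Theorems.FemtoTransferGap

/-- ★ **The r10 joint text is downward hereditary in the level**: restrict the level-`k'` basis (`transplantBasisLR_castLE`); the static clauses
(o0)(o2), (B5), (B6) and the raw ∕ dressed block defects are clauses channel by channel ∕ pair by pair (same constants). [cite: Luscher1983, §3] -/
theorem blockPlateauForL_transplantLR_of_le {k k' : ℕ} (hk : k ≤ k') (h : BlockPlateauForL (TransplantBasisLR k')) :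
    BlockPlateauForL (TransplantBasisLR k) := by
  obtain ⟨C, lam0, hC, hlam0, hmain⟩ := h
  refine ⟨C, lam0, hC, hlam0, fun lam hlam hle => ?_⟩
  obtain ⟨L0, hL0⟩ := hmain lam hlam hle
  refine ⟨L0, fun L _ hL β hW φ hφ => ?_⟩
  obtain ⟨g, hg, hstat, hB5, hB6, hdef⟩ := hL0 L hL β hW φ hφ
  obtain ⟨h0, h2⟩ := hstat
  refine ⟨fun i => g (Fin.castLE hk i), transplantBasisLR_castLE hk hg, ⟨fun i => h0 (Fin.castLE hk i), fun i l hil => ?_⟩,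
    fun i => hB5 (Fin.castLE hk i), fun i l hil => ?_, fun i => hdef (Fin.castLE hk i)⟩
  · exact h2 (Fin.castLE hk i) (Fin.castLE hk l) fun e => hil (Fin.castLE_injective hk e)
  · exact hB6 (Fin.castLE hk i) (Fin.castLE hk l) fun e => hil (Fin.castLE_injective hk e)

/-- All levels of the r10 text from a cofinal family of levels. [cite: Luscher1983, §3] -/
theorem blockPlateauForL_transplantLR_of_cofinal (h : ∀ k : ℕ, ∃ k' : ℕ, k ≤ k' ∧ BlockPlateauForL (TransplantBasisLR k')) :
    ∀ k : ℕ, BlockPlateauForL (TransplantBasisLR k) := fun k => by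
  obtain ⟨k', hk, hk'⟩ := h k
  exact blockPlateauForL_transplantLR_of_le hk hk'

/-- The item BY NAME from the r10 text along a cofinal set of levels (`dressedRitz_of_blockPlateau`, p593581). [cite: Luscher1983, §3] -/
theorem dressedRitz_of_blockPlateau_cofinal (h : ∀ k : ℕ, ∃ k' : ℕ, k ≤ k' ∧ BlockPlateauForL (TransplantBasisLR k')) :
    Summit.QuantumFields.YangMills.Theses.LuscherReduction.DressedRitz :=
  dressedRitz_of_blockPlateau (blockPlateauForL_transplantLR_of_cofinal h)

end Summit.QuantumFields.YangMills.Theorems.FemtoTransferGap.PolyakovLift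

end
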